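import Summits.QuantumFields.YangMills.Theorems.CurvatureKernelBound.Negative.L1Flat

/-!
# `CurvatureKernelBound` — negative lemmas: flat decay of `n`-point off-diagonal test functions at every partial diagonal

Supports crux item `stmt-QuantumFields-11687` (`PencilRigidity.CurvatureKernelBound`). Standing disprover's negative-lemma
infrastructure (refuter, cdisprove cycle 3), generalising `L1Witness.norm_le_flat_of_isOffDiagonal` from `n = 2` to every
arity: for `F ∈ ⁰𝒮((ℝ⁴)ⁿ)` (`IsOffDiagonal F`), every pair `a ≠ b` and every configuration `x` with `‖x_a − x_b‖ ≤ 1`,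
`‖F x‖ ≤ 3ᵏ (‖x_a − x_b‖/2)ᴺ (1+‖x‖)⁻ᵏ · SNn k N F` (`norm_le_flat`: Taylor along the segment from `x` to the configuration
with `x_a, x_b` both replaced by their midpoint, which lies on the coincidence locus where `F` is flat; the one-variable
flatness lemma `L1Witness.norm_iteratedDeriv_le_of_flat`). This is the estimate that makes Wick products of kernels of
order ten integrable against `⁰𝒮ₙ` (the family-level Gaussian witnesses) and the analytic core of Stub A4
`OffDiagonalExtension` in any arity. No conclusion below asserts a Theses statement positively. [folklore]
-/

open scoped BigOperators Topology SchwartzMap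
open MeasureTheory Filter Set Real
open Literature.MathematicalPhysics.QuantumLattice Literature.MathematicalPhysics.AQFT

noncomputable section

namespace Summit.QuantumFields.YangMills.Theorems.CurvatureKernelBound.Negative

namespace FlatN

variable {n : ℕ}

/-- The configuration with `x_a, x_b` both moved to their midpoint. [folklore] -/
def diagPt (a b : Fin n) (x : Fin n → E4) : Fin n → E4 :=
  fun i => if i = a ∨ i = b then (1 / 2 : ℝ) • (x a + x b) else x i

/-- The offset `x − diagPt a b x`. [folklore] -/
def offV (a b : Fin n) (x : Fin n → E4) : Fin n → E4 := x - diagPt a b x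

/-- The midpoint configuration lies on the coincidence locus. [folklore] -/
theorem diagPt_mem {a b : Fin n} (hab : a ≠ b) (x : Fin n → E4) : diagPt a b x ∈ coincidenceLocus n E4 :=
  ⟨a, b, hab, by simp [diagPt]⟩

/-- `diagPt + offV = id`. [folklore] -/
theorem diagPt_add_offV (a b : Fin n) (x : Fin n → E4) : diagPt a b x + offV a b x = x := by
  simp [offV]

/-- The offset at the moved coordinates is `± (x_a − x_b)/2`, elsewhere `0`. [folklore] -/
theorem norm_offV_apply_le (a b : Fin n) (x : Fin n → E4) (i : Fin n) : ‖offV a b x i‖ ≤ ‖x a - x b‖ / 2 := by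
  simp only [offV, diagPt, Pi.sub_apply]
  by_cases h : i = a ∨ i = b
  · rw [if_pos h]
    rcases h with rfl | rfl
    · have : x i - (1 / 2 : ℝ) • (x i + x b) = (1 / 2 : ℝ) • (x i - x b) := by module
      rw [this, norm_smul]; norm_num
      exact le_of_eq (by ring)
    · have : x i - (1 / 2 : ℝ) • (x a + x i) = -((1 / 2 : ℝ) • (x a - x i)) := by module
      rw [this, norm_neg, norm_smul]; norm_num
      exact le_of_eq (by ring)
  · rw [if_neg h, sub_self, norm_zero]
    positivity

/-- `‖offV a b x‖ ≤ ‖x_a − x_b‖/2` (sup norm over the coordinates). [folklore] -/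
theorem norm_offV_le (a b : Fin n) (x : Fin n → E4) : ‖offV a b x‖ ≤ ‖x a - x b‖ / 2 :=
  (pi_norm_le_iff_of_nonneg (by positivity)).2 (norm_offV_apply_le a b x)

/-- Iterated derivatives of the restriction of a Schwartz function to a line (any domain). [folklore] -/
theorem iteratedDeriv_lineAt {D : Type*} [NormedAddCommGroup D] [NormedSpace ℝ D] (N : ℕ) (F : 𝓢(D, ℂ))
    (y v : D) (t : ℝ) :
    iteratedDeriv N (fun s : ℝ => F (y + s • v)) t = iteratedFDeriv ℝ N F (y + t • v) (fun _ => v) := by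
  rw [iteratedDeriv_eq_iteratedFDeriv]
  let g : ℝ →L[ℝ] D := ContinuousLinearMap.toSpanSingleton ℝ v
  have hfun : (fun s : ℝ => F (y + s • v)) = (fun z : D => F (z + y)) ∘ g := by
    funext s
    simp [g, ContinuousLinearMap.toSpanSingleton_apply, add_comm]
  have hF : ContDiff ℝ N (fun z : D => F (z + y)) :=
    (F.smooth N).comp (contDiff_id.add contDiff_const)
  rw [hfun, ContinuousLinearMap.iteratedFDeriv_comp_right g hF t le_rfl]
  simp only [ContinuousMultilinearMap.compContinuousLinearMap_apply]
  rw [iteratedFDeriv_comp_add_right' N y]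
  simp [g, ContinuousLinearMap.toSpanSingleton_apply, add_comm]

/-- The finite family of Schwartz seminorms of orders `≤ (k, N)` on `n`-point test functions. [folklore] -/
abbrev SNn (k N : ℕ) (F : 𝓢((Fin n → E4), ℂ)) : ℝ :=
  (Finset.Iic (k, N)).sup (fun m => SchwartzMap.seminorm ℂ m.1 m.2) F

/-- `SNn` is non-negative. [folklore] -/
theorem SNn_nonneg (k N : ℕ) (F : 𝓢((Fin n → E4), ℂ)) : 0 ≤ SNn k N F := apply_nonneg _ _

/-- **Flat decay at every partial diagonal.** For `F ∈ ⁰𝒮ₙ`, `a ≠ b` and `‖x_a − x_b‖ ≤ 1`: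
`‖F x‖ ≤ 3ᵏ (‖x_a − x_b‖/2)ᴺ (1+‖x‖)⁻ᵏ · SNn k N F`. [folklore] -/
theorem norm_le_flat {F : 𝓢((Fin n → E4), ℂ)} (hF : IsOffDiagonal F) (k N : ℕ) (x : Fin n → E4)
    {a b : Fin n} (hab : a ≠ b) (hx : ‖x a - x b‖ ≤ 1) :
    ‖F x‖ ≤ 3 ^ k * (‖x a - x b‖ / 2) ^ N * (1 + ‖x‖)⁻¹ ^ k * SNn k N F := by
  set y := diagPt a b x with hy
  set v := offV a b x with hv
  have hvn : ‖v‖ ≤ ‖x a - x b‖ / 2 := norm_offV_le a b x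
  have hv2 : ‖v‖ ≤ 1 / 2 := hvn.trans (by linarith)
  set g : ℝ → ℂ := fun s => F (y + s • v) with hg
  have hweight : ∀ t ∈ Icc (0 : ℝ) 1, (1 + ‖y + t • v‖)⁻¹ ≤ 3 / 2 * (1 + ‖x‖)⁻¹ := by
    intro t ht
    have hxz : ‖x‖ ≤ ‖y + t • v‖ + 1 / 2 := by
      have : x = (y + t • v) + (1 - t) • v := by
        rw [← diagPt_add_offV a b x, ← hy, ← hv]; module
      calc ‖x‖ = ‖(y + t • v) + (1 - t) • v‖ := by rw [← this]
        _ ≤ ‖y + t • v‖ + ‖(1 - t) • v‖ := norm_add_le _ _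
        _ ≤ ‖y + t • v‖ + 1 / 2 := by
            rw [norm_smul, Real.norm_of_nonneg (by linarith [ht.2])]
            nlinarith [ht.1, ht.2, norm_nonneg v]
    have hxz' : 1 + ‖x‖ ≤ 3 / 2 * (1 + ‖y + t • v‖) := by nlinarith [norm_nonneg (y + t • v)]
    calc (1 + ‖y + t • v‖)⁻¹ = 3 / 2 * (3 / 2 * (1 + ‖y + t • v‖))⁻¹ := by
          field_simp
      _ ≤ 3 / 2 * (1 + ‖x‖)⁻¹ := by
          gcongr 3 / 2 * ?_
          exact inv_anti₀ (by positivity) hxz'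
  set B := 3 ^ k * (‖x a - x b‖ / 2) ^ N * (1 + ‖x‖)⁻¹ ^ k * SNn k N F with hB
  have hB0 : 0 ≤ B := by positivity
  have hN : ∀ t ∈ Icc (0 : ℝ) 1, ‖iteratedDeriv N g t‖ ≤ B := by
    intro t ht
    rw [hg, iteratedDeriv_lineAt]
    have h1 : ‖iteratedFDeriv ℝ N F (y + t • v) (fun _ => v)‖ ≤
        ‖iteratedFDeriv ℝ N F (y + t • v)‖ * ‖v‖ ^ N := by
      have := (iteratedFDeriv ℝ N F (y + t • v)).le_opNorm (fun _ => v)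
      simpa [Finset.prod_const] using this
    have h2 : (1 + ‖y + t • v‖) ^ k * ‖iteratedFDeriv ℝ N F (y + t • v)‖ ≤ 2 ^ k * SNn k N F :=
      SchwartzMap.one_add_le_sup_seminorm_apply (m := (k, N)) le_rfl le_rfl F _
    have hpos : 0 < (1 + ‖y + t • v‖) ^ k := by positivity
    have h3 : ‖iteratedFDeriv ℝ N F (y + t • v)‖ ≤ 2 ^ k * SNn k N F * (1 + ‖y + t • v‖)⁻¹ ^ k := by
      rw [inv_pow, ← div_eq_mul_inv, le_div_iff₀ hpos, mul_comm]
      exact h2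
    have h4 : (1 + ‖y + t • v‖)⁻¹ ^ k ≤ (3 / 2) ^ k * (1 + ‖x‖)⁻¹ ^ k := by
      rw [← mul_pow]
      exact pow_le_pow_left₀ (by positivity) (hweight t ht) k
    have h5 : ‖v‖ ^ N ≤ (‖x a - x b‖ / 2) ^ N := pow_le_pow_left₀ (norm_nonneg _) hvn N
    calc ‖iteratedFDeriv ℝ N F (y + t • v) (fun _ => v)‖
        ≤ ‖iteratedFDeriv ℝ N F (y + t • v)‖ * ‖v‖ ^ N := h1
      _ ≤ (2 ^ k * SNn k N F * (1 + ‖y + t • v‖)⁻¹ ^ k) * (‖x a - x b‖ / 2) ^ N := by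
          gcongr
      _ ≤ (2 ^ k * SNn k N F * ((3 / 2) ^ k * (1 + ‖x‖)⁻¹ ^ k)) * (‖x a - x b‖ / 2) ^ N := by
          gcongr
      _ = B := by
          rw [hB, show (3 : ℝ) ^ k = 2 ^ k * (3 / 2) ^ k by rw [← mul_pow]; norm_num]
          ring
  have h0 : ∀ j < N, iteratedDeriv j g 0 = 0 := by
    intro j _
    rw [hg, iteratedDeriv_lineAt, zero_smul, add_zero, hF y (diagPt_mem hab x) j]
    rfl
  have hdiff : ∀ j < N, Differentiable ℝ (iteratedDeriv j g) := by
    intro j hj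
    have hsmooth : ContDiff ℝ N g :=
      (F.smooth N).comp ((contDiff_const.add (contDiff_id.smul contDiff_const)))
    exact hsmooth.differentiable_iteratedDeriv j (by exact_mod_cast hj)
  have := L1Witness.norm_iteratedDeriv_le_of_flat hB0 hdiff h0 hN 0 (Nat.zero_le N) 1 ⟨zero_le_one, le_rfl⟩
  rw [iteratedDeriv_zero, hg] at this
  simp only [one_smul] at this
  rwa [hy, hv, diagPt_add_offV] at this

/-- Plain Schwartz decay `‖F x‖ ≤ 2ᵏ (1+‖x‖)⁻ᵏ SNn k 0 F`. [folklore] -/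
theorem norm_le_SNn (F : 𝓢((Fin n → E4), ℂ)) (k : ℕ) (x : Fin n → E4) :
    ‖F x‖ ≤ 2 ^ k * (1 + ‖x‖)⁻¹ ^ k * SNn k 0 F := by
  have h : (1 + ‖x‖) ^ k * ‖F x‖ ≤ 2 ^ k * SNn k 0 F := by
    simpa [norm_iteratedFDeriv_zero] using
      SchwartzMap.one_add_le_sup_seminorm_apply (𝕜 := ℂ) (m := (k, 0)) le_rfl le_rfl F x
  have hpos : 0 < (1 + ‖x‖) ^ k := by positivity
  have h' : ‖F x‖ ≤ (2 ^ k * SNn k 0 F) / (1 + ‖x‖) ^ k := by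
    rw [le_div_iff₀ hpos, mul_comm]; exact h
  calc ‖F x‖ ≤ (2 ^ k * SNn k 0 F) / (1 + ‖x‖) ^ k := h'
    _ = 2 ^ k * (1 + ‖x‖)⁻¹ ^ k * SNn k 0 F := by rw [inv_pow]; ring

/-- Monotonicity of `SNn` in the derivative order. [folklore] -/
theorem SNn_mono_right {k N N' : ℕ} (h : N ≤ N') (F : 𝓢((Fin n → E4), ℂ)) : SNn k N F ≤ SNn k N' F :=
  Seminorm.le_def.1 (Finset.sup_mono (Finset.Iic_subset_Iic.2
    (show ((k, N) : ℕ × ℕ) ≤ (k, N') from Prod.mk_le_mk.2 ⟨le_rfl, h⟩))) F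

end FlatN

end Summit.QuantumFields.YangMills.Theorems.CurvatureKernelBound.Negative
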